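import Summits.RiemannHypothesis.RiemannHypothesis.Theorems.LiTailMidpointZeroTailUniform
import Summits.RiemannHypothesis.RiemannHypothesis.Theorems.LiTailMidpointBridgeUniform
import HarnessLib

/-!
# RiemannHypothesis / LiTailMidpoint — the UNIFORM TAIL–FRESNEL LAW of the Li zeros (RH-FREE for all `n`; `O(log² n)` form)

RH-FREE [rh-li-prover g7].  Cell `pub/rh-li`, LI column of the RH ladder (D-0040/D-0061); banked round-9 material
(`TARGETS.md` §15.5 seed (i) «uniform tail–Fresnel law», eng-6 g4 exhibits 3/4: for every cut in a window around the resonance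
`c_m√n` the released fraction of `m`'s Laguerre term follows the Fresnel profile).  Composition of the two uniform halves in the
tree: the zero side `ZeroTailUniform.liZeroTail_uniform` (this seat: the zeros above the cut `=` minus the Laguerre terms below `m`
minus `m`'s PARTIAL LAGUERRE BRIDGE, uniformly between two resonances) and the bridge side `BridgeUniform.liBridgeTail_uniform`
(rh-li-eng-4 g6: the partial bridge through the Fresnel transition, uniformly on `[t₀/2, 2t₀]`).

* `liZeroTail_fresnel` — for `m ≥ 2` and scales `0 < c₁`, `0 < c₂` with `1/c₁² < log(m+1)`, `log(m−1) < 1/c₂²` and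
  `log m < 4/c₂²` (the last is implied by the second for `m ≥ 3`; for `m = 2` it reads `c₂ < 2(log 2)^{−1/2} = 2.402`) there are
  `N`, `C` with, for all `n ≥ N` and EVERY cut `T ∈ [c₁√n, c₂√n]`,
  `|liZeroTail n T − liSmoothTail n T + Σ_{k ∈ Ico 2 m} liCoffeyTerm k n`
  `   − (Λ(m)/π) m^{−1/2} · Re{ e^{iF(t₀)} F''(t₀)^{−1/2} [fresnelLim − σ(T) fresnelS(√(2(F(T) − F(t₀))))] }| ≤ C log² n`,
  where `F = Fejer.phF n (log m)` is the phase of `m`'s bridge term, `t₀ = Fejer.tz n (log m) = √(n/log m − ¼)` its stationary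
  height, `σ(T) = +1` for `T ≥ t₀` and `−1` for `T < t₀`, `fresnelS X = ∫_0^X e^{iu²/2} du`, `fresnelLim = ∫_0^∞`.

In words: between the resonances of `m+1` and `m−1`, the Li-weighted zeros above the cut `T` (minus their Riemann–von Mangoldt mean)
release the prime powers below `m` WHOLE and the prime power `m` by the INCOMPLETE FRESNEL INTEGRAL of the exact phase increment
`F(T) − F(t₀)`: `½` at `T = t₀` (round 8's midpoint law), `→ 1` for `T ≪ t₀` and `→ 0` for `T ≫ t₀` (round 7's law on either side),
with the Fresnel oscillations in between (eng-6 g4's profile in `X ≍ (c − c_m) n^{1/4}`).  The typed `O(log² n)` absorbs the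
Backlund boundary term `−(2 − 2cos nθ(T))·S(T) = O(log T)` of exhibit 4, which is therefore not visible at this precision.
RH-FREE for all `n` exactly as PART K/M (every zero above the cut is summed whatever its real part); nothing here bears on the truth
of RH; no data of record is added or changed.
-/

noncomputable section

-- D-0017: `Summit.<S>.<S>.…` is the designed namespace of a single-problem summit.
set_option linter.dupNamespace false

open MeasureTheory intervalIntegral Set Complex
open Literature.Analysis.Fourier
open scoped ArithmeticFunction.vonMangoldt

namespace Summit.RiemannHypothesis.RiemannHypothesis.Theorems.LiTheory

namespace FresnelLaw

open Fejer

/-! ### The cut window lies inside `[t₀/2, 2t₀]` -/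

/-- Lower edge: if `1/c₁² < log(m+1)` (`m ≥ 2`) then `t₀/2 ≤ c₁√n` for `t₀ = tz n (log m)` and every `n`
(`t₀ ≤ √(n/log m)` and `1/log m ≤ 2/log(m+1) < 2c₁² ≤ 4c₁²`, as `m + 1 ≤ m²`). -/
theorem tz_half_le {m : ℕ} (hm : 2 ≤ m) {c₁ : ℝ} (hc₁ : 0 < c₁) (hlow : 1 / c₁ ^ 2 < Real.log (m + 1 : ℕ)) (n : ℕ) :
    tz n (Real.log m) / 2 ≤ c₁ * Real.sqrt n := by
  have hm1 : (1 : ℝ) < m := by exact_mod_cast (show 1 < m by omega)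
  have hy : 0 < Real.log m := Real.log_pos hm1
  have hsq : ((m + 1 : ℕ) : ℝ) ≤ (m : ℝ) ^ 2 := by
    have h : (m + 1 : ℕ) ≤ m ^ 2 := by nlinarith
    exact_mod_cast h
  have hlog2 : Real.log (m + 1 : ℕ) ≤ 2 * Real.log m := by
    have e : Real.log ((m : ℝ) ^ 2) = 2 * Real.log m := by
      rw [Real.log_pow]; norm_num
    rw [← e]
    exact Real.log_le_log (by positivity) hsq
  have h1 : 1 / c₁ ^ 2 < 2 * Real.log m := hlow.trans_le hlog2
  have h2 : 1 / Real.log m ≤ 4 * c₁ ^ 2 := by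
    rw [div_lt_iff₀ (by positivity)] at h1
    rw [div_le_iff₀ hy]
    nlinarith
  have hn0 : (0 : ℝ) ≤ n := Nat.cast_nonneg n
  have hle : (n : ℝ) / Real.log m - 1 / 4 ≤ 4 * c₁ ^ 2 * n := by
    have : (n : ℝ) / Real.log m = n * (1 / Real.log m) := by ring
    rw [this]
    nlinarith [mul_le_mul_of_nonneg_left h2 hn0]
  have hs : Real.sqrt (4 * c₁ ^ 2 * n) = 2 * c₁ * Real.sqrt n := by
    rw [show 4 * c₁ ^ 2 * (n : ℝ) = (2 * c₁) ^ 2 * n by ring, Real.sqrt_mul (sq_nonneg _), Real.sqrt_sq (by positivity)]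
  have := Real.sqrt_le_sqrt hle
  rw [hs] at this
  unfold tz
  linarith

/-- Upper edge: if `log m < 4/c₂²` then `c₂√n ≤ 2t₀` for `n ≥ ⌈1/(4/log m − c₂²)⌉₊` (`c₂²n/4 ≤ n/log m − ¼`). -/
theorem le_two_tz {m : ℕ} (hm : 2 ≤ m) {c₂ : ℝ} (hc₂ : 0 < c₂) (hup' : Real.log m < 4 / c₂ ^ 2) {n : ℕ}
    (hn : ⌈1 / (4 / Real.log m - c₂ ^ 2)⌉₊ ≤ n) : c₂ * Real.sqrt n ≤ 2 * tz n (Real.log m) := by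
  have hm1 : (1 : ℝ) < m := by exact_mod_cast (show 1 < m by omega)
  have hy : 0 < Real.log m := Real.log_pos hm1
  set d : ℝ := 4 / Real.log m - c₂ ^ 2 with hd
  have hd0 : 0 < d := by
    rw [hd, sub_pos, lt_div_iff₀ hy]
    rw [lt_div_iff₀ (by positivity)] at hup'
    linarith
  have hnd : 1 / d ≤ n := (Nat.le_ceil _).trans (by exact_mod_cast hn)
  have hn1 : 1 ≤ (n : ℝ) * d := by rwa [div_le_iff₀ hd0] at hnd
  have hn0 : (0 : ℝ) ≤ n := Nat.cast_nonneg n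
  have hkey : (c₂ * Real.sqrt n / 2) ^ 2 ≤ n / Real.log m - 1 / 4 := by
    have hsq : Real.sqrt n ^ 2 = n := Real.sq_sqrt hn0
    have e1 : (c₂ * Real.sqrt n / 2) ^ 2 = c₂ ^ 2 * n / 4 := by rw [div_pow, mul_pow, hsq]; ring
    have e2 : (n : ℝ) * d = 4 * (n / Real.log m) - c₂ ^ 2 * n := by rw [hd]; ring
    rw [e1]
    rw [e2] at hn1
    linarith
  have h := Real.sqrt_le_sqrt hkey
  rw [Real.sqrt_sq (by positivity)] at h
  unfold tz
  linarith

/-! ### The uniform tail–Fresnel law -/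

/-- **The UNIFORM TAIL–FRESNEL LAW of the Li zeros** (RH-FREE for all `n`; `O(log² n)` form; banked round-9 material of the LI
column): for `m ≥ 2` and scales `0 < c₁`, `0 < c₂` with `1/c₁² < log(m+1)`, `log(m−1) < 1/c₂²`, `log m < 4/c₂²` there are `N`, `C`
with, for all `n ≥ N` and every cut `T ∈ [c₁√n, c₂√n]`,
`|liZeroTail n T − liSmoothTail n T + Σ_{k ∈ Ico 2 m} liCoffeyTerm k n − (Λ(m)/π) m^{−1/2}·Re{e^{iF(t₀)} F''(t₀)^{−1/2}
[fresnelLim − σ(T) fresnelS(√(2(F(T) − F(t₀))))]}| ≤ C log² n` (`F = Fejer.phF n (log m)`, `t₀ = Fejer.tz n (log m)`,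
`σ(T) = 1` if `t₀ ≤ T` else `−1`). -/
theorem liZeroTail_fresnel (m : ℕ) (hm : 2 ≤ m) {c₁ c₂ : ℝ} (hc₁ : 0 < c₁) (hc₂ : 0 < c₂)
    (hlow : 1 / c₁ ^ 2 < Real.log (m + 1 : ℕ)) (hup : Real.log (m - 1 : ℕ) < 1 / c₂ ^ 2)
    (hup' : Real.log m < 4 / c₂ ^ 2) :
    ∃ N : ℕ, ∃ C : ℝ, ∀ n : ℕ, N ≤ n → ∀ T : ℝ, c₁ * Real.sqrt n ≤ T → T ≤ c₂ * Real.sqrt n →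
      |liZeroTail n T - liSmoothTail n T + (∑ k ∈ Finset.Ico 2 m, liCoffeyTerm k n)
          - (Λ m : ℝ) / Real.pi * (m : ℝ) ^ (-(1 / 2 : ℝ)) *
            (cexp (I * phF n (Real.log m) (tz n (Real.log m)))
              * ((Real.sqrt (phF2 n (tz n (Real.log m))))⁻¹ : ℝ)
              * (fresnelLim - (if tz n (Real.log m) ≤ T then (1 : ℂ) else -1)
                  * fresnelS (Real.sqrt (2 * (phF n (Real.log m) T - phF n (Real.log m) (tz n (Real.log m))))))).re|
        ≤ C * Real.log n ^ 2 := by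
  have hm0 : (0 : ℝ) < m := by exact_mod_cast (show 0 < m by omega)
  have hm1 : (1 : ℝ) < m := by exact_mod_cast (show 1 < m by omega)
  have hy : 0 < Real.log m := Real.log_pos hm1
  set a : ℝ := (Λ m : ℝ) / Real.pi * (m : ℝ) ^ (-(1 / 2 : ℝ)) with ha_def
  have ha : 0 ≤ a := by
    rw [ha_def]
    exact mul_nonneg (div_nonneg ArithmeticFunction.vonMangoldt_nonneg Real.pi_pos.le) (Real.rpow_nonneg hm0.le _)
  obtain ⟨N₇, C₇, h7⟩ := ZeroTailUniform.liZeroTail_uniform m hm hc₁ hc₂ hlow hup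
  obtain ⟨N₈, C₈, h8⟩ := BridgeUniform.liBridgeTail_uniform (Real.log m) hy
  set ℓ : ℝ := Real.log 2 with hℓ_def
  have hℓ : 0 < ℓ := Real.log_pos (by norm_num)
  refine ⟨max (max N₇ N₈) (max ⌈1 / (4 / Real.log m - c₂ ^ 2)⌉₊ 2), C₇ + a * |C₈| / ℓ, fun n hn T hTl hTu ↦ ?_⟩
  have hn7 : N₇ ≤ n := by omega
  have hn8 : N₈ ≤ n := by omega
  have hn9 : ⌈1 / (4 / Real.log m - c₂ ^ 2)⌉₊ ≤ n := by omega
  have hn2 : 2 ≤ n := by omega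
  have hlo : tz n (Real.log m) / 2 ≤ T := (tz_half_le hm hc₁ hlow n).trans hTl
  have hhi : T ≤ 2 * tz n (Real.log m) := hTu.trans (le_two_tz hm hc₂ hup' hn9)
  have hZ := h7 n hn7 T hTl hTu
  have hB := h8 n hn8 T hlo hhi
  set B : ℝ := liBridgeTail n (Real.log m) T with hB_def
  set M : ℝ := (cexp (I * phF n (Real.log m) (tz n (Real.log m)))
      * ((Real.sqrt (phF2 n (tz n (Real.log m))))⁻¹ : ℝ)
      * (fresnelLim - (if tz n (Real.log m) ≤ T then (1 : ℂ) else -1)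
          * fresnelS (Real.sqrt (2 * (phF n (Real.log m) T - phF n (Real.log m) (tz n (Real.log m))))))).re
    with hM_def
  -- log sizes
  set L : ℝ := Real.log n with hL_def
  have hLℓ : ℓ ≤ L := Real.log_le_log (by norm_num) (by exact_mod_cast hn2)
  have hL0 : 0 ≤ L := hℓ.le.trans hLℓ
  have hL2 : L ≤ L ^ 2 / ℓ := by
    rw [le_div_iff₀ hℓ, sq]; exact mul_le_mul_of_nonneg_left hLℓ hL0
  have hprod : |a * (B + M)| ≤ a * |C₈| / ℓ * L ^ 2 := by
    rw [abs_mul, abs_of_nonneg ha]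
    have h1 : |B + M| ≤ |C₈| * (L ^ 2 / ℓ) :=
      (hB.trans (mul_le_mul_of_nonneg_right (le_abs_self C₈) hL0)).trans
        (mul_le_mul_of_nonneg_left hL2 (abs_nonneg _))
    calc a * |B + M| ≤ a * (|C₈| * (L ^ 2 / ℓ)) := mul_le_mul_of_nonneg_left h1 ha
      _ = a * |C₈| / ℓ * L ^ 2 := by field_simp
  have key : liZeroTail n T - liSmoothTail n T + (∑ k ∈ Finset.Ico 2 m, liCoffeyTerm k n) - a * M
      = (liZeroTail n T - liSmoothTail n T + (∑ k ∈ Finset.Ico 2 m, liCoffeyTerm k n) + a * B) - a * (B + M) := by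
    ring
  rw [key]
  calc |liZeroTail n T - liSmoothTail n T + (∑ k ∈ Finset.Ico 2 m, liCoffeyTerm k n) + a * B - a * (B + M)|
      ≤ |liZeroTail n T - liSmoothTail n T + (∑ k ∈ Finset.Ico 2 m, liCoffeyTerm k n) + a * B| + |a * (B + M)| :=
        abs_sub _ _
    _ ≤ C₇ * L ^ 2 + a * |C₈| / ℓ * L ^ 2 := add_le_add hZ hprod
    _ = (C₇ + a * |C₈| / ℓ) * L ^ 2 := by ring

/-- The same law read at the cut SCALE `c`: for all `n ≥ N` and every `c ∈ [c₁, c₂]`, at the cut `T = c√n` (the form in which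
the leaves `LiZeroTailLaguerre` (`c` off resonance, weight `1`/`0`) and `LiZeroTailMidpoint` (`c = c_m`, weight `½`) are typed). -/
theorem liZeroTail_fresnel_scale (m : ℕ) (hm : 2 ≤ m) {c₁ c₂ : ℝ} (hc₁ : 0 < c₁) (hc₂ : 0 < c₂)
    (hlow : 1 / c₁ ^ 2 < Real.log (m + 1 : ℕ)) (hup : Real.log (m - 1 : ℕ) < 1 / c₂ ^ 2)
    (hup' : Real.log m < 4 / c₂ ^ 2) :
    ∃ N : ℕ, ∃ C : ℝ, ∀ n : ℕ, N ≤ n → ∀ c : ℝ, c₁ ≤ c → c ≤ c₂ →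
      |liZeroTail n (c * Real.sqrt n) - liSmoothTail n (c * Real.sqrt n) + (∑ k ∈ Finset.Ico 2 m, liCoffeyTerm k n)
          - (Λ m : ℝ) / Real.pi * (m : ℝ) ^ (-(1 / 2 : ℝ)) *
            (cexp (I * phF n (Real.log m) (tz n (Real.log m)))
              * ((Real.sqrt (phF2 n (tz n (Real.log m))))⁻¹ : ℝ)
              * (fresnelLim - (if tz n (Real.log m) ≤ c * Real.sqrt n then (1 : ℂ) else -1)
                  * fresnelS (Real.sqrt (2 * (phF n (Real.log m) (c * Real.sqrt n)
                      - phF n (Real.log m) (tz n (Real.log m))))))).re|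
        ≤ C * Real.log n ^ 2 := by
  obtain ⟨N, C, h⟩ := liZeroTail_fresnel m hm hc₁ hc₂ hlow hup hup'
  refine ⟨N, C, fun n hn c hc1 hc2 ↦ h n hn (c * Real.sqrt n) ?_ ?_⟩
  · exact mul_le_mul_of_nonneg_right hc1 (Real.sqrt_nonneg _)
  · exact mul_le_mul_of_nonneg_right hc2 (Real.sqrt_nonneg _)

end FresnelLaw

end Summit.RiemannHypothesis.RiemannHypothesis.Theorems.LiTheory

end
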